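import Summits.QuantumFields.YangMills.Theorems.BalabanUVNodesN19BirkhoffContraction

/-!
# BalabanUVNodes ∕ N19 (NE7) — BIRKHOFF's CONTRACTION THEOREM, V: INDEPENDENT BLOCKS — projective diameters ADD over a tensor product of steps
# (the EXTENSIVITY of `Δ` as a theorem), yet a BLOCK-FACTORISED two-run discrepancy contracts BLOCKWISE, at the blocks' own coefficients
# `Σ_b tanh(Δ_b∕4)·d_b` — not at the hopeless global `tanh((Σ_b Δ_b)∕4)`

Cell `pub-ymgap` (HUMAN RULING D-0062 Track A; D-0149 width seats), seat `pub-ymgap-dag-n19-w2` (WIDTH SEAT 2 of 3 on NODE n19 = NE7), generation g6,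
CLAIM-4 (INBOX).  Route `Summits/QuantumFields/YangMills/Theses/BalabanUVNodes.lean`, key item K3⁷ `SpineGivenEndpointR13SepCoPH` (stmt-QuantumFields-20544); filed
`--kind proof --supports … --as helper`.  COUNT-NEUTRAL.  THEOREMS ONLY (0 `def`, 0 `sorry`).  ADDITIVE — imports this seat's g6 `…N19BirkhoffContraction` (p618587:
`two_rows_le_exp_tanh_mul`, `two_rows_le_exp_dist`) ONLY; modifies nothing.  Companion of this seat's g2 product calculus (`…N19CoreProductBlocks.core_prod`:
`Core` of independent blocks — constants and radii ADD) and of g4 (`…N19TVProductBlocks`: TV radii compose `1 − (1−ρ₁)(1−ρ₂)`).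

WHY.  `…N19BirkhoffContractionSharp.crossRatio_le_of_boltzmann` located the limit of the contraction mechanism: the projective diameter of a realistic lattice step is
EXTENSIVE in the volume, so the GLOBAL coefficient `tanh(Δ∕4)` is `1 − O(e^{−c·vol})`.  This file makes both halves of that remark precise on the simplest structured
datum — two INDEPENDENT blocks (tensor kernel `M((σ₁,σ₂),(τ₁,τ₂)) = M₁ σ₁ τ₁ · M₂ σ₂ τ₂`, product vectors `x(τ₁,τ₂) = x₁ τ₁ · x₂ τ₂`):
* §1 ★★ `crossRatio_tensor_le` — DIAMETERS ADD: the tensor kernel has cross-ratios `≤ e^{Δ₁ + Δ₂}` (and no better in general: §1 `crossRatio_tensor_eq` — the tensor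
  cross-ratio IS the product of the blocks' cross-ratios, so blocks attaining `Δ_b` give a tensor attaining `Δ₁ + Δ₂`).  `n` like blocks ⇒ `Δ = n·Δ_b`: extensive.
* §2 `tensor_image_eq_mul` — the image FACTORISES: `Σ_{(τ₁,τ₂)} M₁ σ₁ τ₁ M₂ σ₂ τ₂ · x₁ τ₁ x₂ τ₂ = (Σ M₁ σ₁ · x₁)·(Σ M₂ σ₂ · x₂)` (`Finset.sum_product` + `Finset.sum_mul_sum`).
* §3 ★★★ `tensor_two_rows_le_exp_sum_tanh_mul` — BLOCKWISE CONTRACTION: for PRODUCT vectors `x = x₁ ⊗ x₂`, `y = y₁ ⊗ y₂` with blockwise Hilbert distances `≤ d₁`, `≤ d₂`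
  and positive block kernels of diameters `≤ Δ₁`, `≤ Δ₂`, the image cross-ratio between ANY two tensor rows is `≤ e^{tanh(Δ₁∕4)·d₁ + tanh(Δ₂∕4)·d₂}` — each block
  contracts at ITS OWN coefficient; the extensive global diameter `Δ₁ + Δ₂` never enters.  ★ `tensor_two_rows_le_exp_sum_dist` — with merely non-negative block kernels,
  `≤ e^{d₁ + d₂}` (blockwise weak contraction; distances of product data ADD, like g2's radii).
So for a two-run discrepancy that FACTORISES over blocks (g2's `core_prod` datum) the mechanism of `…N19CoreCommonStep` §3–§4 runs per block with `O(1)` block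
diameters; what a real RG discrepancy does instead — couple the blocks through polymers ([Balaban1988Convergent] (2.18)) — is exactly the content this bookkeeping
cannot supply (g2's honest framing, unchanged).

HONEST FRAMING.  Count-neutral helper; [folklore] finite-sum bookkeeping on hypothesis SHAPES; ZERO Bałaban content (no RG step is a tensor product of block kernels;
history weights do not factor over blocks); NE2–NE7 ∕ NE1′ NOT PRINTED for d = 4 ∕ NOT proved; N19 NOT discharged; K3⁷ OPEN, v5 untouched, not claimed; counts UNMOVED
(typed 28∕28 · discharged 5∕27, A 5∕28); no count claim.  One finite 𝕋⁴ programme at fixed ε, Bałaban AS PRINTED; R4 closes the conditional finite-𝕋⁴ rung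
`BalabanLadder.UV` only — the YM mass gap (Clay) is NOT proved by any of this; nothing continuum ∕ ℝ⁴ ∕ OS.  No `def`, no `instance`, no `sorry`; standard axioms.
-/

noncomputable section

open Finset Real
open Summit.QuantumFields.YangMills.BalabanUVNodes.N19BirkhoffContraction (two_rows_le_exp_tanh_mul two_rows_le_exp_dist)

namespace Summit.QuantumFields.YangMills.BalabanUVNodes.N19BirkhoffContractionBlocks

variable {κ₁ κ₂ ι₁ ι₂ : Type*} {s₁ : Finset ι₁} {s₂ : Finset ι₂} {R₁ : Finset κ₁} {R₂ : Finset κ₂}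
  {M₁ : κ₁ → ι₁ → ℝ} {M₂ : κ₂ → ι₂ → ℝ} {x₁ y₁ : ι₁ → ℝ} {x₂ y₂ : ι₂ → ℝ} {Δ₁ Δ₂ d₁ d₂ : ℝ}

/-! ## §1 Diameters ADD over a tensor product (extensivity) -/

/-- the tensor kernel's cross-ratio IS the product of the blocks' cross-ratios (an identity). [folklore] -/
theorem crossRatio_tensor_eq (σ₁ σ₁' : κ₁) (σ₂ σ₂' : κ₂) (τ₁ τ₁' : ι₁) (τ₂ τ₂' : ι₂) :
    (M₁ σ₁ τ₁ * M₂ σ₂ τ₂) * (M₁ σ₁' τ₁' * M₂ σ₂' τ₂') * ((M₁ σ₁ τ₁' * M₁ σ₁' τ₁) * (M₂ σ₂ τ₂' * M₂ σ₂' τ₂)) =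
      ((M₁ σ₁ τ₁ * M₁ σ₁' τ₁') * (M₂ σ₂ τ₂ * M₂ σ₂' τ₂')) * ((M₁ σ₁ τ₁' * M₂ σ₂ τ₂') * (M₁ σ₁' τ₁ * M₂ σ₂' τ₂)) := by
  ring

/-- **★★ DIAMETERS ADD** [folklore]: block kernels with non-negative entries and cross-ratios `≤ e^{Δ₁}`, `≤ e^{Δ₂}` ⇒ the tensor kernel
`M((σ₁,σ₂),(τ₁,τ₂)) = M₁ σ₁ τ₁·M₂ σ₂ τ₂` has cross-ratios `≤ e^{Δ₁ + Δ₂}` on `(R₁ ×ˢ R₂) × (s₁ ×ˢ s₂)`.  With `n` like blocks the diameter is `n·Δ_b` — EXTENSIVE. -/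
theorem crossRatio_tensor_le (hM₁ : ∀ σ ∈ R₁, ∀ τ ∈ s₁, 0 ≤ M₁ σ τ) (hM₂ : ∀ σ ∈ R₂, ∀ τ ∈ s₂, 0 ≤ M₂ σ τ)
    (h₁ : ∀ σ ∈ R₁, ∀ σ' ∈ R₁, ∀ τ ∈ s₁, ∀ τ' ∈ s₁, M₁ σ τ * M₁ σ' τ' ≤ exp Δ₁ * (M₁ σ τ' * M₁ σ' τ))
    (h₂ : ∀ σ ∈ R₂, ∀ σ' ∈ R₂, ∀ τ ∈ s₂, ∀ τ' ∈ s₂, M₂ σ τ * M₂ σ' τ' ≤ exp Δ₂ * (M₂ σ τ' * M₂ σ' τ)) :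
    ∀ σ ∈ R₁ ×ˢ R₂, ∀ σ' ∈ R₁ ×ˢ R₂, ∀ τ ∈ s₁ ×ˢ s₂, ∀ τ' ∈ s₁ ×ˢ s₂,
      (M₁ σ.1 τ.1 * M₂ σ.2 τ.2) * (M₁ σ'.1 τ'.1 * M₂ σ'.2 τ'.2) ≤
        exp (Δ₁ + Δ₂) * ((M₁ σ.1 τ'.1 * M₂ σ.2 τ'.2) * (M₁ σ'.1 τ.1 * M₂ σ'.2 τ.2)) := by
  intro σ hσ σ' hσ' τ hτ τ' hτ'
  rw [Finset.mem_product] at hσ hσ' hτ hτ'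
  have e₁ := h₁ σ.1 hσ.1 σ'.1 hσ'.1 τ.1 hτ.1 τ'.1 hτ'.1
  have e₂ := h₂ σ.2 hσ.2 σ'.2 hσ'.2 τ.2 hτ.2 τ'.2 hτ'.2
  have hn₁ : 0 ≤ M₁ σ.1 τ.1 * M₁ σ'.1 τ'.1 := mul_nonneg (hM₁ _ hσ.1 _ hτ.1) (hM₁ _ hσ'.1 _ hτ'.1)
  have hn₂ : 0 ≤ exp Δ₂ * (M₂ σ.2 τ'.2 * M₂ σ'.2 τ.2) := mul_nonneg (exp_pos _).le (mul_nonneg (hM₂ _ hσ.2 _ hτ'.2) (hM₂ _ hσ'.2 _ hτ.2))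
  calc (M₁ σ.1 τ.1 * M₂ σ.2 τ.2) * (M₁ σ'.1 τ'.1 * M₂ σ'.2 τ'.2)
      = (M₁ σ.1 τ.1 * M₁ σ'.1 τ'.1) * (M₂ σ.2 τ.2 * M₂ σ'.2 τ'.2) := by ring
    _ ≤ (M₁ σ.1 τ.1 * M₁ σ'.1 τ'.1) * (exp Δ₂ * (M₂ σ.2 τ'.2 * M₂ σ'.2 τ.2)) := mul_le_mul_of_nonneg_left e₂ hn₁
    _ ≤ (exp Δ₁ * (M₁ σ.1 τ'.1 * M₁ σ'.1 τ.1)) * (exp Δ₂ * (M₂ σ.2 τ'.2 * M₂ σ'.2 τ.2)) := mul_le_mul_of_nonneg_right e₁ hn₂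
    _ = exp (Δ₁ + Δ₂) * ((M₁ σ.1 τ'.1 * M₂ σ.2 τ'.2) * (M₁ σ'.1 τ.1 * M₂ σ'.2 τ.2)) := by rw [exp_add]; ring

/-! ## §2 The image of a product vector under a tensor kernel factorises -/

/-- `Σ_{(τ₁,τ₂) ∈ s₁ ×ˢ s₂} M₁ σ₁ τ₁·M₂ σ₂ τ₂·(x₁ τ₁·x₂ τ₂) = (Σ_{τ₁} M₁ σ₁ τ₁·x₁ τ₁)·(Σ_{τ₂} M₂ σ₂ τ₂·x₂ τ₂)`. [folklore] -/
theorem tensor_image_eq_mul (σ₁ : κ₁) (σ₂ : κ₂) (x₁ : ι₁ → ℝ) (x₂ : ι₂ → ℝ) :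
    ∑ τ ∈ s₁ ×ˢ s₂, (M₁ σ₁ τ.1 * M₂ σ₂ τ.2) * (x₁ τ.1 * x₂ τ.2) =
      (∑ τ₁ ∈ s₁, M₁ σ₁ τ₁ * x₁ τ₁) * (∑ τ₂ ∈ s₂, M₂ σ₂ τ₂ * x₂ τ₂) := by
  rw [Finset.sum_mul_sum, Finset.sum_product]
  exact Finset.sum_congr rfl fun τ₁ _ => Finset.sum_congr rfl fun τ₂ _ => by ring

/-! ## §3 Blockwise contraction: each block at its own coefficient -/

/-- **★★★ A BLOCK-FACTORISED DISCREPANCY CONTRACTS BLOCKWISE** [folklore] (Birkhoff per block).  Positive block kernels `M₁`, `M₂` of diameters `≤ Δ₁`, `≤ Δ₂`;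
product vectors `x = x₁ ⊗ x₂`, `y = y₁ ⊗ y₂` with positive factors at blockwise Hilbert distances `≤ d₁`, `≤ d₂` (`y_b τ·x_b τ′ ≤ e^{d_b}·x_b τ·y_b τ′`).  Then for any two
tensor rows `σ = (σ₁,σ₂)`, `σ′ = (σ₁′,σ₂′)`:
`(M•y)(σ)·(M•x)(σ′) ≤ e^{tanh(Δ₁∕4)·d₁ + tanh(Δ₂∕4)·d₂}·(M•x)(σ)·(M•y)(σ′)` — the GLOBAL diameter `Δ₁ + Δ₂` of §1 never enters. -/
theorem tensor_two_rows_le_exp_sum_tanh_mul (hd₁ : 0 ≤ d₁) (hd₂ : 0 ≤ d₂) (hΔ₁ : 0 ≤ Δ₁) (hΔ₂ : 0 ≤ Δ₂)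
    (hM₁ : ∀ σ ∈ R₁, ∀ τ ∈ s₁, 0 < M₁ σ τ) (hM₂ : ∀ σ ∈ R₂, ∀ τ ∈ s₂, 0 < M₂ σ τ)
    (hx₁ : ∀ τ ∈ s₁, 0 < x₁ τ) (hy₁ : ∀ τ ∈ s₁, 0 < y₁ τ) (hx₂ : ∀ τ ∈ s₂, 0 < x₂ τ) (hy₂ : ∀ τ ∈ s₂, 0 < y₂ τ)
    (hxy₁ : ∀ τ ∈ s₁, ∀ τ' ∈ s₁, y₁ τ * x₁ τ' ≤ exp d₁ * (x₁ τ * y₁ τ'))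
    (hxy₂ : ∀ τ ∈ s₂, ∀ τ' ∈ s₂, y₂ τ * x₂ τ' ≤ exp d₂ * (x₂ τ * y₂ τ'))
    (h₁ : ∀ σ ∈ R₁, ∀ σ' ∈ R₁, ∀ τ ∈ s₁, ∀ τ' ∈ s₁, M₁ σ τ * M₁ σ' τ' ≤ exp Δ₁ * (M₁ σ τ' * M₁ σ' τ))
    (h₂ : ∀ σ ∈ R₂, ∀ σ' ∈ R₂, ∀ τ ∈ s₂, ∀ τ' ∈ s₂, M₂ σ τ * M₂ σ' τ' ≤ exp Δ₂ * (M₂ σ τ' * M₂ σ' τ))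
    {σ σ' : κ₁ × κ₂} (hσ : σ ∈ R₁ ×ˢ R₂) (hσ' : σ' ∈ R₁ ×ˢ R₂) :
    (∑ τ ∈ s₁ ×ˢ s₂, (M₁ σ.1 τ.1 * M₂ σ.2 τ.2) * (y₁ τ.1 * y₂ τ.2)) *
        (∑ τ ∈ s₁ ×ˢ s₂, (M₁ σ'.1 τ.1 * M₂ σ'.2 τ.2) * (x₁ τ.1 * x₂ τ.2)) ≤
      exp (Real.tanh (Δ₁ / 4) * d₁ + Real.tanh (Δ₂ / 4) * d₂) *
        ((∑ τ ∈ s₁ ×ˢ s₂, (M₁ σ.1 τ.1 * M₂ σ.2 τ.2) * (x₁ τ.1 * x₂ τ.2)) *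
          (∑ τ ∈ s₁ ×ˢ s₂, (M₁ σ'.1 τ.1 * M₂ σ'.2 τ.2) * (y₁ τ.1 * y₂ τ.2))) := by
  rw [Finset.mem_product] at hσ hσ'
  rw [tensor_image_eq_mul, tensor_image_eq_mul, tensor_image_eq_mul, tensor_image_eq_mul, exp_add]
  have b₁ := two_rows_le_exp_tanh_mul (s := s₁) (a := M₁ σ.1) (b := M₁ σ'.1) (x := x₁) (y := y₁) hd₁ hΔ₁
    (hM₁ _ hσ.1) (hM₁ _ hσ'.1) hx₁ hy₁ hxy₁ (fun τ hτ τ' hτ' => h₁ _ hσ.1 _ hσ'.1 τ hτ τ' hτ')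
  have b₂ := two_rows_le_exp_tanh_mul (s := s₂) (a := M₂ σ.2) (b := M₂ σ'.2) (x := x₂) (y := y₂) hd₂ hΔ₂
    (hM₂ _ hσ.2) (hM₂ _ hσ'.2) hx₂ hy₂ hxy₂ (fun τ hτ τ' hτ' => h₂ _ hσ.2 _ hσ'.2 τ hτ τ' hτ')
  have hA₁ : 0 ≤ (∑ τ ∈ s₁, M₁ σ.1 τ * y₁ τ) * (∑ τ ∈ s₁, M₁ σ'.1 τ * x₁ τ) :=
    mul_nonneg (sum_nonneg fun τ hτ => (mul_pos (hM₁ _ hσ.1 τ hτ) (hy₁ τ hτ)).le)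
      (sum_nonneg fun τ hτ => (mul_pos (hM₁ _ hσ'.1 τ hτ) (hx₁ τ hτ)).le)
  have hB₂ : 0 ≤ exp (Real.tanh (Δ₂ / 4) * d₂) * ((∑ τ ∈ s₂, M₂ σ.2 τ * x₂ τ) * (∑ τ ∈ s₂, M₂ σ'.2 τ * y₂ τ)) :=
    mul_nonneg (exp_pos _).le (mul_nonneg (sum_nonneg fun τ hτ => (mul_pos (hM₂ _ hσ.2 τ hτ) (hx₂ τ hτ)).le)
      (sum_nonneg fun τ hτ => (mul_pos (hM₂ _ hσ'.2 τ hτ) (hy₂ τ hτ)).le))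
  calc (∑ τ ∈ s₁, M₁ σ.1 τ * y₁ τ) * (∑ τ ∈ s₂, M₂ σ.2 τ * y₂ τ) *
        ((∑ τ ∈ s₁, M₁ σ'.1 τ * x₁ τ) * (∑ τ ∈ s₂, M₂ σ'.2 τ * x₂ τ))
      = ((∑ τ ∈ s₁, M₁ σ.1 τ * y₁ τ) * (∑ τ ∈ s₁, M₁ σ'.1 τ * x₁ τ)) *
          ((∑ τ ∈ s₂, M₂ σ.2 τ * y₂ τ) * (∑ τ ∈ s₂, M₂ σ'.2 τ * x₂ τ)) := by ring
    _ ≤ ((∑ τ ∈ s₁, M₁ σ.1 τ * y₁ τ) * (∑ τ ∈ s₁, M₁ σ'.1 τ * x₁ τ)) *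
          (exp (Real.tanh (Δ₂ / 4) * d₂) * ((∑ τ ∈ s₂, M₂ σ.2 τ * x₂ τ) * (∑ τ ∈ s₂, M₂ σ'.2 τ * y₂ τ))) :=
        mul_le_mul_of_nonneg_left b₂ hA₁
    _ ≤ (exp (Real.tanh (Δ₁ / 4) * d₁) * ((∑ τ ∈ s₁, M₁ σ.1 τ * x₁ τ) * (∑ τ ∈ s₁, M₁ σ'.1 τ * y₁ τ))) *
          (exp (Real.tanh (Δ₂ / 4) * d₂) * ((∑ τ ∈ s₂, M₂ σ.2 τ * x₂ τ) * (∑ τ ∈ s₂, M₂ σ'.2 τ * y₂ τ))) :=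
        mul_le_mul_of_nonneg_right b₁ hB₂
    _ = exp (Real.tanh (Δ₁ / 4) * d₁) * exp (Real.tanh (Δ₂ / 4) * d₂) *
          ((∑ τ ∈ s₁, M₁ σ.1 τ * x₁ τ) * (∑ τ ∈ s₂, M₂ σ.2 τ * x₂ τ) *
            ((∑ τ ∈ s₁, M₁ σ'.1 τ * y₁ τ) * (∑ τ ∈ s₂, M₂ σ'.2 τ * y₂ τ))) := by ring

/-- **★ BLOCKWISE WEAK CONTRACTION** [folklore]: with merely NON-NEGATIVE block kernels the image distance of product data is `≤ d₁ + d₂` — distances of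
independent blocks ADD (like g2's `core_prod` radii), and no common block step inflates them. -/
theorem tensor_two_rows_le_exp_sum_dist
    (hM₁ : ∀ σ ∈ R₁, ∀ τ ∈ s₁, 0 ≤ M₁ σ τ) (hM₂ : ∀ σ ∈ R₂, ∀ τ ∈ s₂, 0 ≤ M₂ σ τ)
    (hx₁ : ∀ τ ∈ s₁, 0 ≤ x₁ τ) (hy₁ : ∀ τ ∈ s₁, 0 ≤ y₁ τ) (hx₂ : ∀ τ ∈ s₂, 0 ≤ x₂ τ) (hy₂ : ∀ τ ∈ s₂, 0 ≤ y₂ τ)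
    (hxy₁ : ∀ τ ∈ s₁, ∀ τ' ∈ s₁, y₁ τ * x₁ τ' ≤ exp d₁ * (x₁ τ * y₁ τ'))
    (hxy₂ : ∀ τ ∈ s₂, ∀ τ' ∈ s₂, y₂ τ * x₂ τ' ≤ exp d₂ * (x₂ τ * y₂ τ'))
    {σ σ' : κ₁ × κ₂} (hσ : σ ∈ R₁ ×ˢ R₂) (hσ' : σ' ∈ R₁ ×ˢ R₂) :
    (∑ τ ∈ s₁ ×ˢ s₂, (M₁ σ.1 τ.1 * M₂ σ.2 τ.2) * (y₁ τ.1 * y₂ τ.2)) *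
        (∑ τ ∈ s₁ ×ˢ s₂, (M₁ σ'.1 τ.1 * M₂ σ'.2 τ.2) * (x₁ τ.1 * x₂ τ.2)) ≤
      exp (d₁ + d₂) *
        ((∑ τ ∈ s₁ ×ˢ s₂, (M₁ σ.1 τ.1 * M₂ σ.2 τ.2) * (x₁ τ.1 * x₂ τ.2)) *
          (∑ τ ∈ s₁ ×ˢ s₂, (M₁ σ'.1 τ.1 * M₂ σ'.2 τ.2) * (y₁ τ.1 * y₂ τ.2))) := by
  rw [Finset.mem_product] at hσ hσ'
  rw [tensor_image_eq_mul, tensor_image_eq_mul, tensor_image_eq_mul, tensor_image_eq_mul, exp_add]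
  have b₁ := two_rows_le_exp_dist (s := s₁) (a := M₁ σ.1) (b := M₁ σ'.1) (x := x₁) (y := y₁) (hM₁ _ hσ.1) (hM₁ _ hσ'.1) hxy₁
  have b₂ := two_rows_le_exp_dist (s := s₂) (a := M₂ σ.2) (b := M₂ σ'.2) (x := x₂) (y := y₂) (hM₂ _ hσ.2) (hM₂ _ hσ'.2) hxy₂
  have hA₁ : 0 ≤ (∑ τ ∈ s₁, M₁ σ.1 τ * y₁ τ) * (∑ τ ∈ s₁, M₁ σ'.1 τ * x₁ τ) :=
    mul_nonneg (sum_nonneg fun τ hτ => mul_nonneg (hM₁ _ hσ.1 τ hτ) (hy₁ τ hτ))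
      (sum_nonneg fun τ hτ => mul_nonneg (hM₁ _ hσ'.1 τ hτ) (hx₁ τ hτ))
  have hB₂ : 0 ≤ exp d₂ * ((∑ τ ∈ s₂, M₂ σ.2 τ * x₂ τ) * (∑ τ ∈ s₂, M₂ σ'.2 τ * y₂ τ)) :=
    mul_nonneg (exp_pos _).le (mul_nonneg (sum_nonneg fun τ hτ => mul_nonneg (hM₂ _ hσ.2 τ hτ) (hx₂ τ hτ))
      (sum_nonneg fun τ hτ => mul_nonneg (hM₂ _ hσ'.2 τ hτ) (hy₂ τ hτ)))
  calc (∑ τ ∈ s₁, M₁ σ.1 τ * y₁ τ) * (∑ τ ∈ s₂, M₂ σ.2 τ * y₂ τ) *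
        ((∑ τ ∈ s₁, M₁ σ'.1 τ * x₁ τ) * (∑ τ ∈ s₂, M₂ σ'.2 τ * x₂ τ))
      = ((∑ τ ∈ s₁, M₁ σ.1 τ * y₁ τ) * (∑ τ ∈ s₁, M₁ σ'.1 τ * x₁ τ)) *
          ((∑ τ ∈ s₂, M₂ σ.2 τ * y₂ τ) * (∑ τ ∈ s₂, M₂ σ'.2 τ * x₂ τ)) := by ring
    _ ≤ ((∑ τ ∈ s₁, M₁ σ.1 τ * y₁ τ) * (∑ τ ∈ s₁, M₁ σ'.1 τ * x₁ τ)) *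
          (exp d₂ * ((∑ τ ∈ s₂, M₂ σ.2 τ * x₂ τ) * (∑ τ ∈ s₂, M₂ σ'.2 τ * y₂ τ))) :=
        mul_le_mul_of_nonneg_left b₂ hA₁
    _ ≤ (exp d₁ * ((∑ τ ∈ s₁, M₁ σ.1 τ * x₁ τ) * (∑ τ ∈ s₁, M₁ σ'.1 τ * y₁ τ))) *
          (exp d₂ * ((∑ τ ∈ s₂, M₂ σ.2 τ * x₂ τ) * (∑ τ ∈ s₂, M₂ σ'.2 τ * y₂ τ))) :=
        mul_le_mul_of_nonneg_right b₁ hB₂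
    _ = exp d₁ * exp d₂ *
          ((∑ τ ∈ s₁, M₁ σ.1 τ * x₁ τ) * (∑ τ ∈ s₂, M₂ σ.2 τ * x₂ τ) *
            ((∑ τ ∈ s₁, M₁ σ'.1 τ * y₁ τ) * (∑ τ ∈ s₂, M₂ σ'.2 τ * y₂ τ))) := by ring

end Summit.QuantumFields.YangMills.BalabanUVNodes.N19BirkhoffContractionBlocks

end
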